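import Mathlib.Algebra.Group.Basic
import Mathlib.Algebra.Group.Pi.Basic
import Mathlib.Data.Fintype.Pi

/-!
# Code lift over a gadget of direct pairs — explicit coordinatewise proof (support file)

Item `stmt-MatrixMultiplication-14308` (`FourierTwoFamiliesModP.PrimeTwoFamilies`, CKSU 2005 Conj. 4.7 with
prime cyclic hosts), line `Sketch` (capacity-gadget form), registered stub `codeLift`.

Setting.  `K` is an additive commutative group, `(P c, Q c)_{c<r}` a list of pairs of finite subsets of
`K` (a GADGET), each pair DIRECT: `(x - x') + (y - y') = 0` with `x, x' ∈ P c`, `y, y' ∈ Q c` forces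
`x = x'` and `y = y'` (`hD`).  A finite set `W` of words `Fin L → Fin r` is a zero-error code for strong
separation (`hW`): for two distinct words `i ≠ k` of `W` there is a coordinate `t` at which every cross
difference `q - p` (`p ∈ P (i t)`, `q ∈ Q (k t)`) differs from every diagonal difference `q' - p'`
(`p' ∈ P c`, `q' ∈ Q c`, any letter `c`).

Claim (`codeLift`).  The product blocks `A w = ∏ₜ P (w t)`, `B w = ∏ₜ Q (w t)` (`w ∈ W`, realised as
`Fintype.piFinset`) satisfy the two clauses of the simultaneous double product property verbatim:
(W) inside one block pair, `(a - a') + (b - b') = 0` forces `a = a'`, `b = b'`;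
(X) across blocks `i, j, k ∈ W`, `a ∈ A i`, `a' ∈ A j`, `b ∈ B j`, `b' ∈ B k` and
`(a - a') + (b - b') = 0` force `i = k`.

Proof (elementary, coordinatewise).  A relation between words is a relation in every coordinate
(`coord_rel`).  For (W) apply directness of the letter `w t` in each coordinate and conclude by function
extensionality.  For (X), if `i ≠ k` pick the separating coordinate `t` of `hW`; the one-line identity
`(x - x') + (y - y') = 0 ⟹ y' - x = y - x'` (`cross_eq_of_rel`) says that the cross difference
`b' t - a t ∈ Q (k t) - P (i t)` equals the diagonal difference `b t - a' t ∈ Q (j t) - P (j t)`, which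
strong separation forbids.
-/

-- single-conjunct summit: the mandated namespace repeats `MatrixMultiplication` (summit = sub-problem).
set_option linter.dupNamespace false

namespace Summit.MatrixMultiplication.MatrixMultiplication.Theorems.PrimeTwoFamilies.CodeLiftK18

/-- A relation `(a - a') + (b - b') = 0` between words `Fin L → K` holds in every coordinate `t`. -/
theorem coord_rel {K : Type*} [AddCommGroup K] {L : ℕ} {a a' b b' : Fin L → K}
    (h : (a - a') + (b - b') = 0) (t : Fin L) : (a t - a' t) + (b t - b' t) = 0 := by
  have ht := congrFun h t
  rw [Pi.add_apply, Pi.sub_apply, Pi.sub_apply, Pi.zero_apply] at ht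
  exact ht

/-- The additive identity behind clause (X): `(x - x') + (y - y') = 0` makes the two cross differences
coincide, `y' - x = y - x'`.  (From `x - x' = -(y - y') = y' - y` and
`y' - x = y - x' ↔ y' - y = x - x'`.) -/
theorem cross_eq_of_rel {K : Type*} [AddCommGroup K] {x x' y y' : K}
    (h : (x - x') + (y - y') = 0) : y' - x = y - x' :=
  have h1 : x - x' = y' - y := (eq_neg_of_add_eq_zero_left h).trans (neg_sub y y')
  sub_eq_sub_iff_sub_eq_sub.2 h1.symm

/-- **CODE LIFT** (registered stub `codeLift` of the capacity-gadget skeleton, verbatim).  If every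
letter `(P c, Q c)` is direct (`hD`) and `W` is a zero-error code for strong separation (`hW`), then the
product blocks `Fintype.piFinset (fun t => P (w t))`, `Fintype.piFinset (fun t => Q (w t))` (`w ∈ W`)
satisfy clause (W) (first conjunct: coordinatewise directness) and clause (X) (second conjunct: at the
separating coordinate the relation would be a forbidden coincidence of a cross difference with a
diagonal difference). -/
theorem codeLift {K : Type*} [AddCommGroup K] [DecidableEq K] {r L : ℕ}
    (P Q : Fin r → Finset K)
    (hD : ∀ c : Fin r, ∀ x ∈ P c, ∀ x' ∈ P c, ∀ y ∈ Q c, ∀ y' ∈ Q c,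
      (x - x') + (y - y') = 0 → x = x' ∧ y = y')
    (W : Finset (Fin L → Fin r))
    (hW : ∀ i ∈ W, ∀ k ∈ W, i ≠ k → ∃ t : Fin L,
      ∀ p ∈ P (i t), ∀ q ∈ Q (k t), ∀ c : Fin r, ∀ p' ∈ P c, ∀ q' ∈ Q c, q - p ≠ q' - p') :
    (∀ w ∈ W, ∀ a ∈ Fintype.piFinset (fun t => P (w t)), ∀ a' ∈ Fintype.piFinset (fun t => P (w t)),
      ∀ b ∈ Fintype.piFinset (fun t => Q (w t)), ∀ b' ∈ Fintype.piFinset (fun t => Q (w t)),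
        (a - a') + (b - b') = 0 → a = a' ∧ b = b') ∧
    (∀ i ∈ W, ∀ j ∈ W, ∀ k ∈ W,
      ∀ a ∈ Fintype.piFinset (fun t => P (i t)), ∀ a' ∈ Fintype.piFinset (fun t => P (j t)),
      ∀ b ∈ Fintype.piFinset (fun t => Q (j t)), ∀ b' ∈ Fintype.piFinset (fun t => Q (k t)),
        (a - a') + (b - b') = 0 → i = k) := by
  constructor
  · -- clause (W): directness of the letter `w t` in every coordinate `t`, then extensionality
    intro w _ a ha a' ha' b hb b' hb' h
    rw [Fintype.mem_piFinset] at ha ha' hb hb'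
    have key : ∀ t, a t = a' t ∧ b t = b' t := fun t =>
      hD (w t) (a t) (ha t) (a' t) (ha' t) (b t) (hb t) (b' t) (hb' t) (coord_rel h t)
    exact ⟨funext fun t => (key t).1, funext fun t => (key t).2⟩
  · -- clause (X): at the separating coordinate `t` of `i ≠ k`, the cross difference `b' t - a t`
    -- (`a t ∈ P (i t)`, `b' t ∈ Q (k t)`) equals the diagonal difference `b t - a' t` of letter `j t`
    intro i hi j _ k hk a ha a' ha' b hb b' hb' h
    rw [Fintype.mem_piFinset] at ha ha' hb hb'
    by_contra hik
    obtain ⟨t, ht⟩ := hW i hi k hk hik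
    exact ht (a t) (ha t) (b' t) (hb' t) (j t) (a' t) (ha' t) (b t) (hb t)
      (cross_eq_of_rel (coord_rel h t))

end Summit.MatrixMultiplication.MatrixMultiplication.Theorems.PrimeTwoFamilies.CodeLiftK18
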